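import Mathlib
import Summits.NavierStokesRegularity.NavierStokesRegularity.Theses.RootDecompThresholdSaddle
import Summits.NavierStokesRegularity.NavierStokesRegularity.Theses.RootDecompFactorLadder
import Summits.NavierStokesRegularity.NavierStokesRegularity.Theorems.RootDecompFactorLadderFakeBreather
import Summits.NavierStokesRegularity.NavierStokesRegularity.Theorems.RootDecompFactorLadderRepresentative

/-!
# decomp-ns · lens 1 (grading) · g24 — POST-REG EXACTNESS (kernel by-product, tree-only imports)

Trigger (a″) of the lens-1 lineage FIRED: REG `TypeIRdssRepresentative` (stmt-NavierStokesRegularity-27745)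
is a theorem since p784291 (`typeIRdssRepresentative_holds`). This file discharges the REG binder everywhere
the lineage's certificates carried it "modulo REG":

* `wall_iff_accumulating_and_pastIsolated` : W (stmt-29252) ⟺ A (stmt-33311) ∧ B^R (stmt-27744) — UNCONDITIONAL
  (was `wall_iff_repaired : W ⟺ REG ∧ A ∧ B^R`);
* `wall_iff_cells` : W ⟺ T (31464) ∧ F (31465) ∧ C^R (27776) — the N15 resplit kit, UNCONDITIONAL
  (was `wall_iff_repaired_cells : W ⟺ T ∧ F ∧ C^R ∧ REG`);
* `closes_postReg` : N26's deciding theorem with three open binders K, A, B^R (REG supplied by name);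
* `closes_of_wall` / `root_of_K_and_cells` : the two equivalent readings of the same cone.

Consequence for the tree (TREE.md N26/N15): the open cone of `RootDecompFactorLadder.closes` is EXACTLY
{K 33312, A 33311, B^R 27744}, and W's residual is A ∧ B^R with no "mod REG" qualifier. No new item, no new cut:
this is bookkeeping the kernel can now certify, nothing more. 0 sorry.
-/

set_option linter.dupNamespace false

namespace Summit.NavierStokesRegularity.NavierStokesRegularity.Theorems.RootDecompFactorLadderPostReg

open Summit.NavierStokesRegularity.NavierStokesRegularity.Theses
open Summit.NavierStokesRegularity.NavierStokesRegularity.Theorems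

/-- **W ⟺ A ∧ B^R, unconditionally** (REG discharged by `typeIRdssRepresentative_holds`). -/
theorem wall_iff_accumulating_and_pastIsolated :
    RootDecompThresholdSaddle.TypeIDssWall ↔
      RootDecompFactorLadder.AccumulatingFactorLiouville ∧ RootDecompFactorLadder.PastIsolatedFactorLiouville := by
  rw [RootDecompFactorLadderFakeBreather.wall_iff_repaired]
  exact ⟨fun h => h.2,
    fun h => ⟨RootDecompFactorLadderRepresentative.typeIRdssRepresentative_holds, h⟩⟩

/-- **W ⟺ T ∧ F ∧ C^R, unconditionally** — the N15 tenure-resplit kit no longer needs a fourth child. -/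
theorem wall_iff_cells :
    RootDecompThresholdSaddle.TypeIDssWall ↔
      RootDecompThresholdSaddle.SmallEnvelopeDssLiouville ∧
        RootDecompThresholdSaddle.FineRatioLargeEnvelopeDssLiouville ∧
          RootDecompThresholdSaddle.PastCoarseRatioLargeEnvelopeDssLiouville := by
  rw [RootDecompFactorLadderFakeBreather.wall_iff_repaired_cells]
  exact ⟨fun h => ⟨h.1, h.2.1, h.2.2.1⟩,
    fun h => ⟨h.1, h.2.1, h.2.2, RootDecompFactorLadderRepresentative.typeIRdssRepresentative_holds'⟩⟩

/-- A ∧ B^R from W (drop binders) — the cheap direction, restated for citation. -/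
theorem accumulating_and_pastIsolated_of_wall (hW : RootDecompThresholdSaddle.TypeIDssWall) :
    RootDecompFactorLadder.AccumulatingFactorLiouville ∧ RootDecompFactorLadder.PastIsolatedFactorLiouville :=
  wall_iff_accumulating_and_pastIsolated.1 hW

/-- **N26's deciding theorem after REG**: three open binders. -/
theorem closes_postReg (hK : RootDecompFactorLadder.ThresholdSaddleConeRest)
    (hA : RootDecompFactorLadder.AccumulatingFactorLiouville)
    (hBR : RootDecompFactorLadder.PastIsolatedFactorLiouville) : NavierStokesRegularity :=
  RootDecompFactorLadder.closes hK RootDecompFactorLadderRepresentative.typeIRdssRepresentative_holds hA hBR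

/-- The same cone read through W: K ∧ W ⟹ Clay (A) (N15's `closes`, K unpacked). -/
theorem closes_of_wall (hK : RootDecompFactorLadder.ThresholdSaddleConeRest)
    (hW : RootDecompThresholdSaddle.TypeIDssWall) : NavierStokesRegularity :=
  RootDecompThresholdSaddle.closes hK.1 hK.2.1 hK.2.2.1 hK.2.2.2 hW

/-- The same cone read through the N15 cells: K ∧ T ∧ F ∧ C^R ⟹ Clay (A), no REG binder. -/
theorem root_of_K_and_cells (hK : RootDecompFactorLadder.ThresholdSaddleConeRest)
    (hT : RootDecompThresholdSaddle.SmallEnvelopeDssLiouville)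
    (hF : RootDecompThresholdSaddle.FineRatioLargeEnvelopeDssLiouville)
    (hCR : RootDecompThresholdSaddle.PastCoarseRatioLargeEnvelopeDssLiouville) : NavierStokesRegularity :=
  closes_of_wall hK (wall_iff_cells.2 ⟨hT, hF, hCR⟩)

/-- Consistency: the two three-binder readings agree (A ∧ B^R and T ∧ F ∧ C^R are the same proposition W). -/
theorem cells_iff_accumulating_and_pastIsolated :
    (RootDecompThresholdSaddle.SmallEnvelopeDssLiouville ∧
        RootDecompThresholdSaddle.FineRatioLargeEnvelopeDssLiouville ∧
          RootDecompThresholdSaddle.PastCoarseRatioLargeEnvelopeDssLiouville) ↔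
      (RootDecompFactorLadder.AccumulatingFactorLiouville ∧ RootDecompFactorLadder.PastIsolatedFactorLiouville) :=
  wall_iff_cells.symm.trans wall_iff_accumulating_and_pastIsolated

end Summit.NavierStokesRegularity.NavierStokesRegularity.Theorems.RootDecompFactorLadderPostReg
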